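import Literature.NumberTheory.LFunctions.RiemannSiegelIntegralFormula
import Literature.NumberTheory.LFunctions.RiemannSiegelPhase
import Literature.Analysis.SpecialFunctions.DigammaStirlingSecondOrder
import HarnessLib

/-!
# Stirling's formula for the factor `χ(s)` of the functional equation (Titchmarsh (4.12.3))

Topic `Literature/NumberTheory/LFunctions`. Everything in this file is PROVED; there are no
definitions and no named facts.

The functional equation `ζ(s) = χ(s) ζ(1 − s)` has `χ(s) = 2^s π^{s−1} sin(πs/2) Γ(1−s)
= (2π)^s/(2Γ(s)cos(πs/2))` (Titchmarsh (2.1.8)–(2.1.9); in the tree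
`Literature.NumberTheory.LFunctions.SiegelIntegral.rsChi`, equal off the integers to
`Literature.NumberTheory.LFunctions.riemannZetaChi`). Titchmarsh, *The Theory of the Riemann
Zeta-Function*, §4.12: "in any fixed strip `α ≤ σ ≤ β`, as `t → ∞` …
`χ(s) = (2π/t)^{σ+it−½} e^{i(t+¼π)} {1 + O(1/t)}` (4.12.3)"; this is Levinson's (2.14)
("It is a consequence of Stirling's formula that for `|σ| < 10`,
`χ(s) = (t/2π)^{1/2−σ} exp[πi/4 − it log(t/2πe)] (1 + O(1/t))`", *Adv. Math.* 13 (1974), §2),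
the input for the cross terms of every mean-value computation based on the approximate functional
equation (Levinson's `I₁₂`, §§3, 13; Titchmarsh §7.4). The tree so far had `|χ(s)| ≍ (t/2π)^{½−σ}`
only up to constant factors (`GammaVerticalBounds.lean`, `RiemannSiegelChiBounds.lean`: "Mathlib
has no complex Stirling formula"). Here we prove the asymptotic with an explicit, admissible
(not optimal) constant:

* `rsChi_stirling_of_abs_le` — for `1 ≤ A`, `|σ| ≤ A`, `t ≥ 38(A+1)²` there is `η`,
  `‖η‖ ≤ 38(A+1)²/t`, with
  `χ(σ+it) = (t/2π)^{½−σ} e^{i(π/4 + t − t log(t/2π))} (1 + η)`;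
  `rsChi_stirling` — the case `0 < σ ≤ A` with `t ≥ 8A²`, `‖η‖ ≤ 19A²/t`;
  `norm_rsChi_sub_stirling_le`, `abs_norm_rsChi_sub_rpow_le` (difference and modulus forms),
  `riemannZetaChi_stirling_of_abs_le` (the same for `riemannZetaChi`).

## Proof

No branch of `log Γ` is chosen. Three proved inputs of the tree are combined:

1. **The critical line, exactly**: `χ(½+it) = e^{−2iθ(t)}` (`rsChi_half_eq_cexp_theta`), from
   `χ(s) = Γℝ(1−s)/Γℝ(s)` (Mathlib's `Gammaℝ_div_Gammaℝ_one_sub`), `Γℝ(s̄) = conj Γℝ(s)` and the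
   phase identity `Γℝ(½+it) = ρ(t) e^{iθ(t)}`, `ρ(t) > 0`
   (`Literature.NumberTheory.LFunctions.Gammaℝ_half_add_mul_I`,
   `Literature.NumberTheory.LFunctions.thetaGamma_thetaArg_eq`, `RiemannSiegelPhase.lean`); then
   Stirling's formula for `θ`, `θ(t) = (t/2)log(t/2π) − t/2 − π/8 + O(1/t)`
   (`Literature.NumberTheory.LFunctions.abs_riemannSiegelTheta_sub_stirling_le`), gives
   `χ(½+it) = e^{i(π/4 + t − t log(t/2π))}(1 + O(1/t))` (`rsChi_half_stirling`).
2. **Stirling for the ratio `Γ(σ+it)/Γ(½+it)`** (`Gamma_vertical_eq_Gamma_half_mul_cexp`):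
   the tree's `Γ(w₀+δ) = Γ(w₀) exp(F(w₀+δ) − F(w₀) + O(δ/|Im w₀|²))`, `F(w) = (w−½)Log w − w`
   (`Literature.Analysis.SpecialFunctions.Complex.Gamma_eq_mul_exp_stirlingPrim_horizontal`,
   from the second-order Stirling bound for `ψ`), together with the elementary expansion
   `F(σ+it) − F(½+it) = (σ−½)(log t + iπ/2) + O_A(1/t)` (`ChiStirling.norm_stirlingPrim_sub_sub_le`:
   `Log(σ+it) = log t + iπ/2 + Log(1 − iσ/t)` and `Log(σ+it) − Log(½+it) = Log(1 + (σ−½)/(½+it))`,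
   with Mathlib's bounds for `Log(1+z)`), i.e.
   `Γ(σ+it) = Γ(½+it) t^{σ−½} e^{iπ(σ−½)/2} (1 + O_A(1/t))` (Titchmarsh (4.12.1)–(4.12.2) in
   ratio form).
3. `2cos(πs/2) = e^{−iπs/2}(1 + e^{iπs})` with `|e^{iπs}| = e^{−πt}`, whence
   `χ(σ+it)/χ(½+it) = (t/2π)^{½−σ}(1 + O_A(1/t))` (`rsChi_eq_rsChi_half_mul`).

The strip `−A ≤ σ ≤ 0` is reached by `χ(s)χ(1−s) = 1` and `χ(s̄) = conj χ(s)`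
(`rsChi_mul_rsChi_one_sub`, `rsChi_conj`, from the tree's `riemannZetaChi` versions).

## References

* E. C. Titchmarsh, *The Theory of the Riemann Zeta-Function*, 2nd ed. revised by
  D. R. Heath-Brown, Oxford 1986, §2.1 (2.1.8)–(2.1.11), §4.12 (4.12.1)–(4.12.3), §4.17.
  [Titchmarsh1986]
* N. Levinson, *More than one third of zeros of Riemann's zeta-function are on `σ = 1/2`*,
  Adv. Math. 13 (1974), 383–436, §2 eq. (2.14). [Levinson1974]
-/

noncomputable section

open Complex Real Set Filter
open scoped ComplexConjugate

namespace Literature.NumberTheory.LFunctions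

open SiegelIntegral
open Literature.Analysis.SpecialFunctions.Complex (stirlingPrim
  Gamma_eq_mul_exp_stirlingPrim_horizontal)

-- Auxiliary lemmas live in `Literature.NumberTheory.LFunctions.ChiStirling`.
namespace ChiStirling
end ChiStirling
open ChiStirling

/-! ### `χ` on the critical line: `χ(½ + it) = e^{−2iθ(t)}` -/

/-- `χ(s) = Γℝ(1 − s)/Γℝ(s)` for `s` not an odd negative integer... actually for `s ≠ −(2n+1)`
(`χ = rsChi = feFactor⁻¹`, Mathlib's `Γℝ(s)/Γℝ(1−s) = Γℂ(s) cos(πs/2)`).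
[cite: Titchmarsh1986, §2.1 eqs. (2.1.8)–(2.1.10)] -/
theorem ChiStirling.rsChi_eq_Gammaℝ_div (s : ℂ) (hs : ∀ n : ℕ, s ≠ -(2 * n + 1)) :
    rsChi s = Gammaℝ (1 - s) / Gammaℝ s := by
  have hfe : ZetaM4.feFactor s = Gammaℝ s / Gammaℝ (1 - s) := by
    rw [Gammaℝ_div_Gammaℝ_one_sub hs, Gammaℂ_def, ZetaM4.feFactor]
  rw [rsChi_eq_inv_feFactor, hfe, inv_div]

/-- `Γℝ(½ + it) = ρ(t) e^{iθ(t)}` with `ρ(t) > 0` (the tree's phase identity for `θ`,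
`Literature.NumberTheory.LFunctions.Gammaℝ_half_add_mul_I` and
`Literature.NumberTheory.LFunctions.thetaGamma_thetaArg_eq`). [cite: Titchmarsh1986, §4.17 eq. (4.17.2)] -/
theorem ChiStirling.Gammaℝ_half_eq_ofReal_mul_cexp (t : ℝ) :
    ∃ ρ : ℝ, 0 < ρ ∧ Gammaℝ (1 / 2 + t * I) = (ρ : ℂ) * cexp (riemannSiegelTheta t * I) := by
  refine ⟨Real.exp (-Real.log π / 4) * Real.Gamma (1 / 4) * Real.exp (thetaLogNorm t),
    by have := Real_Gamma_quarter_pos; positivity, ?_⟩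
  rw [Gammaℝ_half_add_mul_I, thetaGamma_thetaArg_eq, Complex.exp_add]
  push_cast
  ring

/-- **`χ(½ + it) = e^{−2iθ(t)}`** (exact; `θ` the Riemann–Siegel theta function of the tree).
[cite: Titchmarsh1986, §4.17] -/
theorem rsChi_half_eq_cexp_theta (t : ℝ) :
    rsChi (1 / 2 + t * I) = cexp (-(2 * riemannSiegelTheta t) * I) := by
  obtain ⟨ρ, hρ, hG⟩ := Gammaℝ_half_eq_ofReal_mul_cexp t
  have hodd : ∀ n : ℕ, (1 / 2 + t * I : ℂ) ≠ -(2 * n + 1) := by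
    intro n h
    have := congrArg Complex.re h
    simp at this
    linarith [n.cast_nonneg (α := ℝ)]
  have h1 : (1 : ℂ) - (1 / 2 + t * I) = conj (1 / 2 + t * I) := by
    apply Complex.ext
    · simp; norm_num
    · simp
  rw [rsChi_eq_Gammaℝ_div _ hodd, h1, Gammaℝ_conj, hG, map_mul, Complex.conj_ofReal,
    ← Complex.exp_conj, map_mul, Complex.conj_ofReal, Complex.conj_I]
  have hρ0 : (ρ : ℂ) ≠ 0 := by exact_mod_cast hρ.ne'
  rw [mul_div_mul_left _ _ hρ0, ← Complex.exp_sub]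
  congr 1
  ring

/-! ### Logarithms near the imaginary axis -/

/-- For `Re w ≥ 0`, `w ≠ 0` and `‖z‖ < 1`: `Log(w(1+z)) = Log w + Log(1+z)` (no winding:
`|arg w| ≤ π/2` and `|arg(1+z)| < π/2`). [folklore] -/
theorem ChiStirling.log_mul_one_add {w z : ℂ} (hw : 0 ≤ w.re) (hw0 : w ≠ 0) (hz : ‖z‖ < 1) :
    Complex.log (w * (1 + z)) = Complex.log w + Complex.log (1 + z) := by
  have hz1 : 0 < (1 + z).re := by
    have h1 : |z.re| ≤ ‖z‖ := Complex.abs_re_le_norm z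
    rw [add_re, one_re]
    linarith [neg_abs_le z.re]
  have hz0 : 1 + z ≠ 0 := fun h ↦ by rw [h] at hz1; simp at hz1
  rw [Complex.log_mul_eq_add_log_iff hw0 hz0]
  have h1 : |arg (1 + z)| < π / 2 := Complex.abs_arg_lt_pi_div_two_iff.2 (Or.inl hz1)
  have h2 : arg w ≤ π / 2 := Complex.arg_le_pi_div_two_iff.2 (Or.inl hw)
  have h3 : -(π / 2) ≤ arg w := Complex.neg_pi_div_two_le_arg_iff.2 (Or.inl hw)
  constructor
  · linarith [(abs_lt.1 h1).1]
  · linarith [(abs_lt.1 h1).2]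

/-- `Log(x + it) = log t + iπ/2 + Log(1 − ix/t)` for `t > 0`, `|x| < t` (`x + it = it(1 − ix/t)`,
`Log(it) = log t + iπ/2`). [folklore] -/
theorem ChiStirling.log_ofReal_add_mul_I {x t : ℝ} (ht : 0 < t) (hxt : |x| < t) :
    Complex.log (x + t * I) = Real.log t + π / 2 * I + Complex.log (1 + -((x : ℂ) / t) * I) := by
  have ht' : (t : ℂ) ≠ 0 := by exact_mod_cast ht.ne'
  have hz : ‖-((x : ℂ) / t) * I‖ < 1 := by
    rw [norm_mul, Complex.norm_I, mul_one, norm_neg, norm_div, Complex.norm_real, Complex.norm_real,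
      Real.norm_eq_abs, Real.norm_eq_abs, abs_of_pos ht, div_lt_one ht]
    exact hxt
  have hw : ((t : ℂ) * I) ≠ 0 := mul_ne_zero ht' I_ne_zero
  have hfac : (x : ℂ) + t * I = (t * I) * (1 + -((x : ℂ) / t) * I) := by
    have e : (t : ℂ) * I * (-((x : ℂ) / t) * I) = x := by
      calc (t : ℂ) * I * (-((x : ℂ) / t) * I) = -((x : ℂ) / t * t) * (I * I) := by ring
        _ = x := by rw [I_mul_I, div_mul_cancel₀ _ ht']; ring
    rw [mul_add, mul_one, e, add_comm]
  rw [hfac, log_mul_one_add (by simp) hw hz, Complex.log_ofReal_mul ht I_ne_zero, Complex.log_I]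

/-! ### The Stirling primitive between `½ + it` and `σ + it` -/

/-- **`F(σ+it) − F(½+it) = (σ − ½)(log t + iπ/2) + O(1/t)`** for the Stirling primitive
`F(w) = (w − ½) Log w − w`: for `0 < σ ≤ A`, `1 ≤ A`, `t ≥ 2A`,
`‖F(σ+it) − F(½+it) − (σ − ½)(log t + iπ/2)‖ ≤ 3A²/t`. [folklore] -/
theorem ChiStirling.norm_stirlingPrim_sub_sub_le {A σ t : ℝ} (hA : 1 ≤ A) (hσ0 : 0 < σ) (hσA : σ ≤ A)
    (ht : 2 * A ≤ t) :
    ‖stirlingPrim (σ + t * I) - stirlingPrim (1 / 2 + t * I) -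
        (σ - 1 / 2) * (Real.log t + π / 2 * I)‖ ≤ 3 * A ^ 2 / t := by
  have ht0 : 0 < t := by linarith
  have ht' : (t : ℂ) ≠ 0 := by exact_mod_cast ht0.ne'
  have hdA : |σ - 1 / 2| ≤ A := by rw [abs_le]; constructor <;> linarith
  set s₀ : ℂ := 1 / 2 + t * I with hs₀
  set z₁ : ℂ := -((σ : ℂ) / t) * I with hz₁
  set z₂ : ℂ := ((σ - 1 / 2 : ℝ) : ℂ) / s₀ with hz₂
  -- sizes
  have hs₀im : s₀.im = t := by simp [hs₀]
  have hs₀norm : t ≤ ‖s₀‖ := by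
    have := Complex.abs_im_le_norm s₀
    rwa [hs₀im, abs_of_pos ht0] at this
  have hs₀0 : s₀ ≠ 0 := fun h ↦ by
    have := hs₀im; rw [h] at this; simp at this; linarith
  have hz₁n : ‖z₁‖ = σ / t := by
    rw [hz₁, norm_mul, Complex.norm_I, mul_one, norm_neg, norm_div, Complex.norm_real,
      Complex.norm_real, Real.norm_eq_abs, Real.norm_eq_abs, abs_of_pos hσ0, abs_of_pos ht0]
  have hz₁le : ‖z₁‖ ≤ 1 / 2 := by
    rw [hz₁n, div_le_iff₀ ht0]; linarith
  have hz₂n : ‖z₂‖ ≤ A / t := by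
    rw [hz₂, norm_div, Complex.norm_real, Real.norm_eq_abs]
    calc |σ - 1 / 2| / ‖s₀‖ ≤ A / ‖s₀‖ := by gcongr
      _ ≤ A / t := by gcongr
  have hAt : A / t ≤ 1 / 2 := by rw [div_le_iff₀ ht0]; linarith
  have hz₂le : ‖z₂‖ ≤ 1 / 2 := hz₂n.trans hAt
  -- the two logarithms
  have hL₁ : Complex.log (σ + t * I) = Real.log t + π / 2 * I + Complex.log (1 + z₁) :=
    log_ofReal_add_mul_I ht0 (by rw [abs_of_pos hσ0]; linarith)
  have hfac : (σ : ℂ) + t * I = s₀ * (1 + z₂) := by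
    rw [hz₂, mul_add, mul_one, mul_div_cancel₀ _ hs₀0, hs₀]
    push_cast
    ring
  have hL₂ : Complex.log (σ + t * I) = Complex.log s₀ + Complex.log (1 + z₂) := by
    rw [hfac]
    exact log_mul_one_add (by simp [hs₀]) hs₀0 (by linarith)
  -- algebra
  have htI : (t : ℂ) * I = s₀ - 1 / 2 := by rw [hs₀]; ring
  have key : stirlingPrim (σ + t * I) - stirlingPrim (1 / 2 + t * I) -
      (σ - 1 / 2) * (Real.log t + π / 2 * I) =
      (σ - 1 / 2 : ℂ) * Complex.log (1 + z₁) + t * I * (Complex.log (1 + z₂) - z₂) -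
        (σ - 1 / 2 : ℂ) / (2 * s₀) := by
    have e1 : stirlingPrim (σ + t * I) =
        ((σ - 1 / 2 : ℂ) + t * I) * Complex.log (σ + t * I) - (σ + t * I) := by
      simp only [stirlingPrim]; ring
    have e2 : stirlingPrim (1 / 2 + t * I) = t * I * Complex.log s₀ - s₀ := by
      simp only [stirlingPrim, hs₀]; ring
    have hL₀ : Complex.log s₀ = Real.log t + π / 2 * I + Complex.log (1 + z₁) - Complex.log (1 + z₂) := by
      rw [← hL₁, hL₂]; ring
    rw [e1, e2, add_mul, hL₀, hL₁]
    have hz₂' : (t : ℂ) * I * z₂ = (σ - 1 / 2 : ℂ) - (σ - 1 / 2 : ℂ) / (2 * s₀) := by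
      rw [htI, hz₂]
      field_simp
      push_cast
      ring
    rw [hs₀] at hz₂' ⊢
    linear_combination hz₂'
  rw [key]
  -- the three bounds
  have hb1 : ‖(σ - 1 / 2 : ℂ) * Complex.log (1 + z₁)‖ ≤ 3 / 2 * A ^ 2 / t := by
    rw [norm_mul, show (σ - 1 / 2 : ℂ) = ((σ - 1 / 2 : ℝ) : ℂ) by push_cast; ring, Complex.norm_real,
      Real.norm_eq_abs]
    have h := Complex.norm_log_one_add_half_le_self hz₁le
    rw [hz₁n] at h
    calc |σ - 1 / 2| * ‖Complex.log (1 + z₁)‖ ≤ A * (3 / 2 * (σ / t)) :=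
          mul_le_mul hdA h (norm_nonneg _) (by linarith)
      _ ≤ A * (3 / 2 * (A / t)) := by gcongr
      _ = 3 / 2 * A ^ 2 / t := by ring
  have hb2 : ‖(t : ℂ) * I * (Complex.log (1 + z₂) - z₂)‖ ≤ A ^ 2 / t := by
    rw [norm_mul, norm_mul, Complex.norm_I, mul_one, Complex.norm_real, Real.norm_eq_abs,
      abs_of_pos ht0]
    have h : ‖Complex.log (1 + z₂) - z₂‖ ≤ ‖z₂‖ ^ 2 := by
      refine (Complex.norm_log_one_add_sub_self_le (lt_of_le_of_lt hz₂le one_half_lt_one)).trans ?_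
      have h1 : (1 - ‖z₂‖)⁻¹ ≤ 2 := by
        rw [inv_le_comm₀ (by linarith) two_pos]; linarith
      calc ‖z₂‖ ^ 2 * (1 - ‖z₂‖)⁻¹ / 2 ≤ ‖z₂‖ ^ 2 * 2 / 2 := by gcongr
        _ = ‖z₂‖ ^ 2 := by ring
    calc t * ‖Complex.log (1 + z₂) - z₂‖ ≤ t * (A / t) ^ 2 := by
          refine mul_le_mul_of_nonneg_left (h.trans ?_) ht0.le
          exact pow_le_pow_left₀ (norm_nonneg _) hz₂n 2
      _ = A ^ 2 / t := by field_simp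
  have hb3 : ‖(σ - 1 / 2 : ℂ) / (2 * s₀)‖ ≤ 1 / 2 * A ^ 2 / t := by
    rw [norm_div, show (σ - 1 / 2 : ℂ) = ((σ - 1 / 2 : ℝ) : ℂ) by push_cast; ring, Complex.norm_real,
      Real.norm_eq_abs, norm_mul, Complex.norm_two]
    have h2s : 2 * t ≤ 2 * ‖s₀‖ := by linarith
    calc |σ - 1 / 2| / (2 * ‖s₀‖) ≤ A / (2 * t) := by
          rw [div_le_div_iff₀ (by positivity) (by positivity)]
          calc |σ - 1 / 2| * (2 * t) ≤ A * (2 * t) := by gcongr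
            _ ≤ A * (2 * ‖s₀‖) := by gcongr
      _ ≤ A ^ 2 / (2 * t) := by
          gcongr
          nlinarith
      _ = 1 / 2 * A ^ 2 / t := by ring
  calc _ ≤ ‖(σ - 1 / 2 : ℂ) * Complex.log (1 + z₁) + t * I * (Complex.log (1 + z₂) - z₂)‖ +
        ‖(σ - 1 / 2 : ℂ) / (2 * s₀)‖ := norm_sub_le _ _
    _ ≤ (‖(σ - 1 / 2 : ℂ) * Complex.log (1 + z₁)‖ + ‖(t : ℂ) * I * (Complex.log (1 + z₂) - z₂)‖) +
        ‖(σ - 1 / 2 : ℂ) / (2 * s₀)‖ := by gcongr; exact norm_add_le _ _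
    _ ≤ (3 / 2 * A ^ 2 / t + A ^ 2 / t) + 1 / 2 * A ^ 2 / t := by gcongr
    _ = 3 * A ^ 2 / t := by ring

/-- **Stirling for `Γ` between `½ + it` and `σ + it`** (Titchmarsh (4.12.1)–(4.12.2), in ratio
form): for `0 < σ ≤ A`, `1 ≤ A`, `t ≥ 2A` there is `E` with `‖E‖ ≤ 4A²/t` and
`Γ(σ+it) = Γ(½+it) · exp((σ − ½)(log t + iπ/2) + E)`, i.e.
`Γ(σ+it) = Γ(½+it) t^{σ−½} e^{iπ(σ−½)/2} (1 + O_A(1/t))`.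
[cite: Titchmarsh1986, §4.12 eqs. (4.12.1)–(4.12.2)] -/
theorem Gamma_vertical_eq_Gamma_half_mul_cexp {A σ t : ℝ} (hA : 1 ≤ A) (hσ0 : 0 < σ) (hσA : σ ≤ A)
    (ht : 2 * A ≤ t) :
    ∃ E : ℂ, ‖E‖ ≤ 4 * A ^ 2 / t ∧
      Gamma (σ + t * I) = Gamma (1 / 2 + t * I) *
        cexp ((σ - 1 / 2) * (Real.log t + π / 2 * I) + E) := by
  have ht0 : 0 < t := by linarith
  have ht1 : 1 ≤ t := by linarith
  have hdA : |σ - 1 / 2| ≤ A := by rw [abs_le]; constructor <;> linarith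
  have hP := norm_stirlingPrim_sub_sub_le hA hσ0 hσA ht
  set P := stirlingPrim (σ + t * I) - stirlingPrim (1 / 2 + t * I) -
    (σ - 1 / 2) * (Real.log t + π / 2 * I) with hPdef
  -- the Stirling error of the tree's lemma is `≤ δ/t ≤ A²/t` for `t ≥ 2`
  have herr : ∀ δ : ℝ, 0 ≤ δ → δ ≤ A →
      2 * δ * (1 / (6 * t ^ 3) + π / (12 * t ^ 2)) ≤ A ^ 2 / t := by
    intro δ hδ hδA
    have h1 : 1 / (6 * t ^ 3) ≤ 1 / (6 * t) := by
      apply one_div_le_one_div_of_le (by positivity)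
      have h3 : 0 ≤ t * (t - 1) * (t + 1) :=
        mul_nonneg (mul_nonneg ht0.le (sub_nonneg.2 ht1)) (by linarith)
      nlinarith [h3]
    have h2 : π / (12 * t ^ 2) ≤ 4 / (12 * t) := by
      rw [div_le_div_iff₀ (by positivity) (by positivity)]
      nlinarith [Real.pi_lt_four, Real.pi_pos]
    calc 2 * δ * (1 / (6 * t ^ 3) + π / (12 * t ^ 2)) ≤ 2 * δ * (1 / (6 * t) + 4 / (12 * t)) := by
          gcongr
      _ = δ / t := by field_simp; ring
      _ ≤ A ^ 2 / t := by
          gcongr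
          nlinarith
  rcases le_or_gt (1 / 2 : ℝ) σ with hσ | hσ
  · -- `σ ≥ ½`: segment from `½ + it` to `σ + it`
    obtain ⟨E₀, hE₀, hΓ⟩ := Gamma_eq_mul_exp_stirlingPrim_horizontal (w₀ := 1 / 2 + t * I)
      (δ := σ - 1 / 2) (by simp) (by simpa using ht0) (by linarith)
    have him : (1 / 2 + t * I : ℂ).im = t := by simp
    rw [him] at hE₀
    have hw : (1 / 2 + t * I : ℂ) + ((σ - 1 / 2 : ℝ) : ℂ) = σ + t * I := by push_cast; ring
    rw [hw] at hΓ
    refine ⟨P + E₀, ?_, ?_⟩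
    · calc ‖P + E₀‖ ≤ ‖P‖ + ‖E₀‖ := norm_add_le _ _
        _ ≤ 3 * A ^ 2 / t + A ^ 2 / t :=
            add_le_add hP (hE₀.trans (herr _ (by linarith) (by rw [abs_of_nonneg (by linarith)] at hdA; exact hdA)))
        _ = 4 * A ^ 2 / t := by ring
    · rw [hΓ]
      congr 2
      rw [hPdef]
      ring
  · -- `σ < ½`: segment from `σ + it` to `½ + it`
    obtain ⟨E₀, hE₀, hΓ⟩ := Gamma_eq_mul_exp_stirlingPrim_horizontal (w₀ := σ + t * I)
      (δ := 1 / 2 - σ) (by simpa using hσ0) (by simpa using ht0) (by linarith)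
    have him : (σ + t * I : ℂ).im = t := by simp
    rw [him] at hE₀
    have hw : (σ + t * I : ℂ) + ((1 / 2 - σ : ℝ) : ℂ) = 1 / 2 + t * I := by push_cast; ring
    rw [hw] at hΓ
    refine ⟨P - E₀, ?_, ?_⟩
    · calc ‖P - E₀‖ ≤ ‖P‖ + ‖E₀‖ := norm_sub_le _ _
        _ ≤ 3 * A ^ 2 / t + A ^ 2 / t :=
            add_le_add hP (hE₀.trans (herr _ (by linarith) (by rw [abs_of_neg (by linarith)] at hdA; linarith)))
        _ = 4 * A ^ 2 / t := by ring
    · rw [hΓ, mul_assoc, ← Complex.exp_add]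
      conv_lhs => rw [← mul_one (Gamma (σ + t * I)), ← Complex.exp_zero]
      congr 2
      rw [hPdef]
      ring

/-! ### The functional-equation factor off the critical line -/

/-- `2 cos(πs/2) = e^{−iπs/2} (1 + e^{iπs})`. [folklore] -/
theorem ChiStirling.two_mul_cos_pi_mul_div_two (s : ℂ) :
    2 * Complex.cos (π * s / 2) = cexp (-(π * s / 2 * I)) * (1 + cexp (π * s * I)) := by
  rw [Complex.two_cos, add_comm, mul_add, mul_one, ← Complex.exp_add]
  congr 2 <;> ring

/-- `‖e^{iπ(σ+it)}‖ = e^{−πt}`. [folklore] -/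
theorem ChiStirling.norm_cexp_pi_mul_mul_I (σ t : ℝ) :
    ‖cexp (π * (σ + t * I) * I)‖ = Real.exp (-(π * t)) := by
  rw [Complex.norm_exp]
  congr 1
  simp [mul_re, mul_im]

/-- `e^{−πt} ≤ 1/(πt)` for `t > 0`. [folklore] -/
theorem ChiStirling.exp_neg_pi_mul_le {t : ℝ} (ht : 0 < t) : Real.exp (-(π * t)) ≤ 1 / (π * t) := by
  have h := Real.add_one_le_exp (π * t)
  have hpt : 0 < π * t := by positivity
  rw [Real.exp_neg, inv_eq_one_div, div_le_div_iff₀ (Real.exp_pos _) hpt]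
  nlinarith

/-- `χ(s) = (2π)^s e^{iπs/2} / (Γ(s) (1 + e^{iπs}))` (from `χ = (2π)^s/(2Γ(s)cos(πs/2))`).
[cite: Titchmarsh1986, §2.1 eqs. (2.1.8)–(2.1.9)] -/
theorem ChiStirling.rsChi_eq_cexp_div (s : ℂ) :
    rsChi s = (2 * π) ^ s * cexp (π * s / 2 * I) / (Gamma s * (1 + cexp (π * s * I))) := by
  rw [rsChi_def, show 2 * Gamma s * Complex.cos (π * s / 2) = Gamma s * (2 * Complex.cos (π * s / 2))
    by ring, two_mul_cos_pi_mul_div_two, Complex.exp_neg]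
  have h := Complex.exp_ne_zero (π * s / 2 * I)
  field_simp

/-- The real power `(t/2π)^{½−σ}` as a complex exponential. [folklore] -/
theorem ChiStirling.ofReal_rpow_eq_cexp {t : ℝ} (ht : 0 < t) (a : ℝ) :
    (((t / (2 * π)) ^ a : ℝ) : ℂ) = cexp ((a * (Real.log t - Real.log (2 * π)) : ℝ)) := by
  rw [Real.rpow_def_of_pos (by positivity), Complex.ofReal_exp, Real.log_div ht.ne' (by positivity)]
  push_cast
  ring_nf

/-- Algebra of the error terms: `x(1+y)/(1+u) − 1 = a + b + ab` with `a = x − 1`,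
`b = (y − u)/(1 + u)`. [folklore] -/
theorem ChiStirling.mul_div_sub_one_eq {x y u : ℂ} (hu : 1 + u ≠ 0) :
    x * (1 + y) / (1 + u) - 1 = (x - 1) + (y - u) / (1 + u) + (x - 1) * ((y - u) / (1 + u)) := by
  field_simp
  ring

/-- Algebra of the ratio `χ(s)/χ(s₀)`: abstract form. [folklore] -/
theorem ChiStirling.ratio_identity {Ps P₀ R eD eE Γ₀ u u₀ : ℂ} (hΓ₀ : Γ₀ ≠ 0) (hu : 1 + u ≠ 0)
    (hu₀ : 1 + u₀ ≠ 0) (heD : eD ≠ 0) (heE : eE ≠ 0) (hP : Ps = P₀ * R * eD) :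
    Ps / (Γ₀ * (eD * eE) * (1 + u)) = P₀ / (Γ₀ * (1 + u₀)) * R * (1 + (eE⁻¹ * (1 + u₀) / (1 + u) - 1)) := by
  rw [hP]
  field_simp
  ring

/-- **`χ(σ+it) = χ(½+it) (t/2π)^{½−σ} (1 + O_A(1/t))`**: for `0 < σ ≤ A`, `1 ≤ A`, `t ≥ 8A²`
there is `η` with `‖η‖ ≤ 11A²/t` and `χ(σ+it) = χ(½+it) (t/2π)^{½−σ} (1 + η)` (the ratio
`Γ(½+it)/Γ(σ+it)` by `Gamma_vertical_eq_Gamma_half_mul_cexp`, the ratio of the cosines is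
`e^{iπ(σ−½)/2}(1 + O(e^{−πt}))`). [cite: Titchmarsh1986, §4.12 (4.12.3)] -/
theorem rsChi_eq_rsChi_half_mul {A σ t : ℝ} (hA : 1 ≤ A) (hσ0 : 0 < σ) (hσA : σ ≤ A)
    (ht : 8 * A ^ 2 ≤ t) :
    ∃ η : ℂ, ‖η‖ ≤ 11 * A ^ 2 / t ∧
      rsChi (σ + t * I) = rsChi (1 / 2 + t * I) * (((t / (2 * π)) ^ (1 / 2 - σ) : ℝ) : ℂ) * (1 + η) := by
  have hA2 : 1 ≤ A ^ 2 := one_le_pow₀ hA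
  have ht8 : 8 ≤ t := le_trans (by linarith) ht
  have ht0 : 0 < t := by linarith
  have hAA : A ≤ A ^ 2 := by nlinarith
  have h2A : 2 * A ≤ t := by linarith
  obtain ⟨E, hE, hΓ⟩ := Gamma_vertical_eq_Gamma_half_mul_cexp hA hσ0 hσA h2A
  -- the two small exponentials `u = e^{iπs}`, `u₀ = e^{iπs₀}`
  have hun : ‖cexp (π * (σ + t * I) * I)‖ = Real.exp (-(π * t)) := norm_cexp_pi_mul_mul_I σ t
  have hu₀n : ‖cexp (π * (1 / 2 + t * I) * I)‖ = Real.exp (-(π * t)) := by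
    have := norm_cexp_pi_mul_mul_I (1 / 2) t
    push_cast at this
    exact this
  have hexp_le : Real.exp (-(π * t)) ≤ 1 / (3 * t) := by
    refine (exp_neg_pi_mul_le ht0).trans ?_
    gcongr
    linarith [Real.pi_gt_three]
  have hexp_small : Real.exp (-(π * t)) ≤ 1 / 24 := by
    refine hexp_le.trans ?_
    rw [div_le_div_iff₀ (by positivity) (by norm_num)]
    linarith
  have h1u : 1 / 2 ≤ ‖1 + cexp (π * (σ + t * I) * I)‖ := by
    have h := norm_sub_norm_le (1 : ℂ) (-cexp (π * (σ + t * I) * I))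
    rw [sub_neg_eq_add, norm_neg, norm_one, hun] at h
    linarith
  have h1u0 : 1 + cexp (π * (σ + t * I) * I) ≠ 0 := by
    intro h; rw [h, norm_zero] at h1u; linarith
  have h1u₀0 : 1 + cexp (π * (1 / 2 + t * I) * I) ≠ 0 := by
    intro h
    have h' := norm_sub_norm_le (1 : ℂ) (-cexp (π * (1 / 2 + t * I) * I))
    rw [sub_neg_eq_add, norm_neg, norm_one, hu₀n, h, norm_zero] at h'
    linarith
  have hΓ₀ : Gamma (1 / 2 + t * I) ≠ 0 := Complex.Gamma_ne_zero_of_re_pos (by simp)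
  refine ⟨(cexp E)⁻¹ * (1 + cexp (π * (1 / 2 + t * I) * I)) / (1 + cexp (π * (σ + t * I) * I)) - 1,
    ?_, ?_⟩
  · -- the bound: `η = a + b + ab`, `a = e^{-E} − 1`, `b = (u₀ − u)/(1 + u)`
    rw [mul_div_sub_one_eq h1u0]
    have hEa : ‖(cexp E)⁻¹ - 1‖ ≤ 8 * A ^ 2 / t := by
      have hE1 : ‖-E‖ ≤ 1 := by
        rw [norm_neg]; refine hE.trans ?_
        rw [div_le_one ht0]; linarith
      rw [← Complex.exp_neg]
      calc ‖cexp (-E) - 1‖ ≤ 2 * ‖-E‖ := Complex.norm_exp_sub_one_le hE1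
        _ ≤ 2 * (4 * A ^ 2 / t) := by rw [norm_neg]; gcongr
        _ = 8 * A ^ 2 / t := by ring
    have hbb : ‖(cexp (π * (1 / 2 + t * I) * I) - cexp (π * (σ + t * I) * I)) /
        (1 + cexp (π * (σ + t * I) * I))‖ ≤ 4 / 3 / t := by
      rw [norm_div]
      calc _ ≤ (‖cexp (π * (1 / 2 + t * I) * I)‖ + ‖cexp (π * (σ + t * I) * I)‖) / (1 / 2) := by
            gcongr; exact norm_sub_le _ _
        _ = 4 * Real.exp (-(π * t)) := by rw [hun, hu₀n]; ring
        _ ≤ 4 * (1 / (3 * t)) := by gcongr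
        _ = 4 / 3 / t := by ring
    have h43 : 4 / 3 / t ≤ 4 / 3 * A ^ 2 / t := by
      rw [div_le_div_iff_of_pos_right ht0]; nlinarith
    calc _ ≤ ‖(cexp E)⁻¹ - 1‖ + ‖(cexp (π * (1 / 2 + t * I) * I) - cexp (π * (σ + t * I) * I)) /
          (1 + cexp (π * (σ + t * I) * I))‖ + ‖((cexp E)⁻¹ - 1) *
          ((cexp (π * (1 / 2 + t * I) * I) - cexp (π * (σ + t * I) * I)) /
            (1 + cexp (π * (σ + t * I) * I)))‖ := norm_add₃_le
      _ ≤ 8 * A ^ 2 / t + 4 / 3 / t + (8 * A ^ 2 / t) * (4 / 3 / t) := by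
          gcongr
          rw [norm_mul]
          exact mul_le_mul hEa hbb (norm_nonneg _) (by positivity)
      _ ≤ 8 * A ^ 2 / t + 4 / 3 * A ^ 2 / t + (8 * A ^ 2 / t) * (4 / 3 / 8) := by
          gcongr
      _ = 32 / 3 * A ^ 2 / t := by ring
      _ ≤ 11 * A ^ 2 / t := by gcongr; norm_num
  · -- the identity
    have hπ0 : (2 * π : ℂ) ≠ 0 := by
      rw [show (2 * π : ℂ) = ((2 * π : ℝ) : ℂ) by push_cast; ring]
      exact_mod_cast (by positivity : (2 * π : ℝ) ≠ 0)
    have hlog2π : Complex.log (2 * π) = ((Real.log (2 * π) : ℝ) : ℂ) := by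
      rw [show (2 * π : ℂ) = ((2 * π : ℝ) : ℂ) by push_cast; ring, ← Complex.ofReal_log (by positivity)]
    have hexp : (2 * π : ℂ) ^ (σ + t * I : ℂ) * cexp (π * (σ + t * I) / 2 * I) =
        (2 * π : ℂ) ^ (1 / 2 + t * I : ℂ) * cexp (π * (1 / 2 + t * I) / 2 * I) *
          (((t / (2 * π)) ^ (1 / 2 - σ) : ℝ) : ℂ) *
          cexp ((σ - 1 / 2) * (Real.log t + π / 2 * I)) := by
      rw [Complex.cpow_def_of_ne_zero hπ0, Complex.cpow_def_of_ne_zero hπ0, hlog2π,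
        ofReal_rpow_eq_cexp ht0, ← Complex.exp_add, ← Complex.exp_add, ← Complex.exp_add,
        ← Complex.exp_add]
      congr 1
      push_cast
      ring
    rw [rsChi_eq_cexp_div, rsChi_eq_cexp_div, hΓ, Complex.exp_add]
    exact ratio_identity hΓ₀ h1u0 h1u₀0 (Complex.exp_ne_zero _) (Complex.exp_ne_zero _) hexp

/-- **`χ(½+it) = e^{i(π/4 + t − t log(t/2π))} (1 + O(1/t))`** (from `χ(½+it) = e^{−2iθ(t)}` and
Stirling's formula for `θ`, `Literature.NumberTheory.LFunctions.abs_riemannSiegelTheta_sub_stirling_le`):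
for `t ≥ 2`, `χ(½+it) = e^{i(π/4 + t − t log(t/2π))}(1 + η)` with `‖η‖ ≤ 3/t`.
[cite: Titchmarsh1986, §4.12 (4.12.3), §4.17] -/
theorem rsChi_half_stirling {t : ℝ} (ht : 2 ≤ t) :
    ∃ η : ℂ, ‖η‖ ≤ 3 / t ∧
      rsChi (1 / 2 + t * I) = cexp ((π / 4 + t - t * Real.log (t / (2 * π))) * I) * (1 + η) := by
  have ht0 : 0 < t := by linarith
  have hθ := abs_riemannSiegelTheta_sub_stirling_le ht
  set ρ : ℝ := riemannSiegelTheta t - (t / 2 * Real.log (t / (2 * π)) - t / 2 - π / 8) with hρ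
  have hK : 2 * stirlingVertRate (1 / 4) ≤ 3 / 2 := by
    simp only [stirlingVertRate]
    nlinarith [Real.pi_lt_four]
  refine ⟨cexp (I * ((-(2 * ρ) : ℝ) : ℂ)) - 1, ?_, ?_⟩
  · calc ‖cexp (I * ((-(2 * ρ) : ℝ) : ℂ)) - 1‖ ≤ ‖(-(2 * ρ) : ℝ)‖ := norm_exp_I_mul_ofReal_sub_one_le
      _ = 2 * |ρ| := by rw [Real.norm_eq_abs, abs_neg, abs_mul, abs_two]
      _ ≤ 2 * (2 * stirlingVertRate (1 / 4) / t) := by gcongr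
      _ ≤ 3 / t := by
          rw [mul_div_assoc', div_le_div_iff_of_pos_right ht0]; linarith
  · rw [rsChi_half_eq_cexp_theta, add_sub_cancel, ← Complex.exp_add]
    congr 1
    have : riemannSiegelTheta t = ρ + (t / 2 * Real.log (t / (2 * π)) - t / 2 - π / 8) := by
      rw [hρ]; ring
    rw [this]
    push_cast
    ring

/-- **Stirling's formula for `χ` (Titchmarsh (4.12.3); Levinson 1974 (2.14)).** For `1 ≤ A`,
`0 < σ ≤ A` and `t ≥ 8A²` there is `η` with `‖η‖ ≤ 19A²/t` and
`χ(σ + it) = (t/2π)^{½−σ} e^{i(π/4 + t − t log(t/2π))} (1 + η)`.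
[cite: Titchmarsh1986, §4.12 eq. (4.12.3)] -/
theorem rsChi_stirling {A σ t : ℝ} (hA : 1 ≤ A) (hσ0 : 0 < σ) (hσA : σ ≤ A) (ht : 8 * A ^ 2 ≤ t) :
    ∃ η : ℂ, ‖η‖ ≤ 19 * A ^ 2 / t ∧
      rsChi (σ + t * I) = (((t / (2 * π)) ^ (1 / 2 - σ) : ℝ) : ℂ) *
        cexp ((π / 4 + t - t * Real.log (t / (2 * π))) * I) * (1 + η) := by
  have hA2 : 1 ≤ A ^ 2 := by nlinarith
  have ht8 : 8 ≤ t := by nlinarith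
  have ht0 : 0 < t := by linarith
  obtain ⟨η₁, hη₁, h₁⟩ := rsChi_eq_rsChi_half_mul hA hσ0 hσA ht
  obtain ⟨η₀, hη₀, h₀⟩ := rsChi_half_stirling (t := t) (by linarith)
  refine ⟨η₀ + η₁ + η₀ * η₁, ?_, ?_⟩
  · have hprod : ‖η₀ * η₁‖ ≤ 5 * A ^ 2 / t := by
      rw [norm_mul]
      calc ‖η₀‖ * ‖η₁‖ ≤ (3 / t) * (11 * A ^ 2 / t) :=
            mul_le_mul hη₀ hη₁ (norm_nonneg _) (by positivity)
        _ ≤ (3 / 8) * (11 * A ^ 2 / t) := by gcongr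
        _ ≤ 5 * A ^ 2 / t := by
            rw [mul_div_assoc', div_le_div_iff_of_pos_right ht0]; nlinarith
    have h0' : ‖η₀‖ ≤ 3 * A ^ 2 / t :=
      hη₀.trans (by rw [div_le_div_iff_of_pos_right ht0]; nlinarith)
    calc ‖η₀ + η₁ + η₀ * η₁‖ ≤ ‖η₀‖ + ‖η₁‖ + ‖η₀ * η₁‖ := norm_add₃_le
      _ ≤ 3 * A ^ 2 / t + 11 * A ^ 2 / t + 5 * A ^ 2 / t := by gcongr
      _ = 19 * A ^ 2 / t := by ring
  · rw [h₁, h₀]; ring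

/-! ### Reflection and conjugation; the strip `|σ| ≤ A` -/

/-- `sin(πs) ≠ 0` off the real axis. [folklore] -/
theorem ChiStirling.sin_pi_mul_ne_zero {s : ℂ} (hs : s.im ≠ 0) : Complex.sin (π * s) ≠ 0 := by
  intro h
  obtain ⟨k, hk⟩ := Complex.sin_eq_zero_iff.1 h
  have h1 := congrArg Complex.im hk
  simp only [mul_im, ofReal_re, ofReal_im, zero_mul, add_zero, intCast_re, intCast_im,
    mul_zero] at h1
  exact hs ((mul_eq_zero.1 h1).resolve_left Real.pi_ne_zero)

/-- `χ(s̄) = conj χ(s)` off the real axis (the tree's `riemannZetaChi_conj`). [folklore] -/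
theorem rsChi_conj {s : ℂ} (hs : s.im ≠ 0) : rsChi (conj s) = conj (rsChi s) := by
  have hs' : (conj s).im ≠ 0 := by simpa using hs
  rw [rsChi_eq_riemannZetaChi (sin_pi_mul_ne_zero hs), rsChi_eq_riemannZetaChi (sin_pi_mul_ne_zero hs'),
    riemannZetaChi_conj]

/-- `χ(s) χ(1 − s) = 1` off the real axis (the tree's `riemannZetaChi_mul_one_sub`).
[cite: Titchmarsh1986, §2.1 eq. (2.1.11)] -/
theorem rsChi_mul_rsChi_one_sub {s : ℂ} (hs : s.im ≠ 0) : rsChi s * rsChi (1 - s) = 1 := by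
  have hs' : (1 - s).im ≠ 0 := by simpa using hs
  rw [rsChi_eq_riemannZetaChi (sin_pi_mul_ne_zero hs), rsChi_eq_riemannZetaChi (sin_pi_mul_ne_zero hs')]
  exact riemannZetaChi_mul_one_sub (sin_pi_mul_ne_zero hs)

/-- **Stirling's formula for `χ` on `|σ| ≤ A`** (Titchmarsh (4.12.3) "in any fixed strip";
Levinson 1974 (2.14) "for `|σ| < 10`"): for `1 ≤ A`, `|σ| ≤ A` and `t ≥ 38(A+1)²` there is `η`
with `‖η‖ ≤ 38(A+1)²/t` and `χ(σ + it) = (t/2π)^{½−σ} e^{i(π/4 + t − t log(t/2π))} (1 + η)`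
(for `σ ≤ 0` by `χ(s) = 1/χ(1−s) = 1/conj χ(1 − s̄)` from the case `Re > 0`).
[cite: Titchmarsh1986, §4.12 eq. (4.12.3)] -/
theorem rsChi_stirling_of_abs_le {A σ t : ℝ} (hA : 1 ≤ A) (hσA : |σ| ≤ A)
    (ht : 38 * (A + 1) ^ 2 ≤ t) :
    ∃ η : ℂ, ‖η‖ ≤ 38 * (A + 1) ^ 2 / t ∧
      rsChi (σ + t * I) = (((t / (2 * π)) ^ (1 / 2 - σ) : ℝ) : ℂ) *
        cexp ((π / 4 + t - t * Real.log (t / (2 * π))) * I) * (1 + η) := by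
  have hA1 : 1 ≤ (A + 1) ^ 2 := one_le_pow₀ (by linarith)
  have ht0 : 0 < t := by nlinarith
  have hσ1 := (abs_le.1 hσA).1
  have hσ2 := (abs_le.1 hσA).2
  rcases lt_or_ge 0 σ with hσ | hσ
  · have h8 : 8 * A ^ 2 ≤ t := by nlinarith
    obtain ⟨η, hη, h⟩ := rsChi_stirling hA hσ hσ2 h8
    refine ⟨η, hη.trans ?_, h⟩
    rw [div_le_div_iff_of_pos_right ht0]
    nlinarith
  · -- reflect: `σ' = 1 − σ ∈ [1, A + 1]`
    obtain ⟨η', hη', h'⟩ := rsChi_stirling (A := A + 1) (σ := 1 - σ) (t := t) (by linarith)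
      (by linarith) (by linarith) (by nlinarith)
    have hη'2 : ‖η'‖ ≤ 1 / 2 := by
      refine hη'.trans ?_
      rw [div_le_iff₀ ht0]; linarith
    have htI : ((σ : ℂ) + t * I).im ≠ 0 := by simpa using ht0.ne'
    have hrefl : rsChi (σ + t * I) = (conj (rsChi ((1 - σ : ℝ) + t * I)))⁻¹ := by
      have h1 := rsChi_mul_rsChi_one_sub htI
      have h2 : (1 : ℂ) - (σ + t * I) = conj (((1 - σ : ℝ) : ℂ) + t * I) := by
        apply Complex.ext <;> simp
      rw [h2, rsChi_conj (by simpa using ht0.ne')] at h1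
      exact eq_inv_of_mul_eq_one_left h1
    refine ⟨(1 + conj η')⁻¹ - 1, ?_, ?_⟩
    · -- `‖(1 + w)⁻¹ − 1‖ = ‖w‖/‖1 + w‖ ≤ 2‖w‖` for `w = conj η'`, `‖w‖ ≤ ½`
      have hw : ‖conj η'‖ ≤ 1 / 2 := by rwa [Complex.norm_conj]
      have h1 : 1 / 2 ≤ ‖1 + conj η'‖ := by
        have h := norm_sub_norm_le (1 : ℂ) (-conj η')
        rw [sub_neg_eq_add, norm_neg, norm_one] at h
        linarith
      have h0 : 1 + conj η' ≠ 0 := by intro h; rw [h, norm_zero] at h1; linarith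
      have e : (1 + conj η')⁻¹ - 1 = -conj η' / (1 + conj η') := by field_simp; ring
      rw [e, norm_div, norm_neg, div_le_iff₀ (by linarith), Complex.norm_conj]
      calc ‖η'‖ = 2 * ‖η'‖ * (1 / 2) := by ring
        _ ≤ 2 * (19 * (A + 1) ^ 2 / t) * ‖1 + conj η'‖ := by gcongr
        _ = 38 * (A + 1) ^ 2 / t * ‖1 + conj η'‖ := by ring
    · have hpos : 0 < t / (2 * π) := by positivity
      have hR : (t / (2 * π)) ^ (1 / 2 - σ) = ((t / (2 * π)) ^ (1 / 2 - (1 - σ)))⁻¹ := by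
        rw [← Real.rpow_neg hpos.le]; congr 1; ring
      have hM : conj (cexp ((π / 4 + t - t * Real.log (t / (2 * π))) * I)) =
          (cexp ((π / 4 + t - t * Real.log (t / (2 * π))) * I))⁻¹ := by
        rw [← Complex.exp_conj, ← Complex.exp_neg]
        congr 1
        simp only [map_mul, map_sub, map_add, map_div₀, Complex.conj_ofReal, Complex.conj_I,
          Complex.conj_ofNat]
        ring
      rw [hrefl, h', map_mul, map_mul, Complex.conj_ofReal, hM, map_add, map_one, mul_inv, mul_inv,
        inv_inv, hR, add_sub_cancel]
      push_cast
      ring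

/-- **Stirling's formula for `χ`, difference form**: for `1 ≤ A`, `|σ| ≤ A`, `t ≥ 38(A+1)²`,
`‖χ(σ+it) − (t/2π)^{½−σ} e^{i(π/4 + t − t log(t/2π))}‖ ≤ (38(A+1)²/t) · (t/2π)^{½−σ}`.
[cite: Titchmarsh1986, §4.12 eq. (4.12.3)] -/
theorem norm_rsChi_sub_stirling_le {A σ t : ℝ} (hA : 1 ≤ A) (hσA : |σ| ≤ A)
    (ht : 38 * (A + 1) ^ 2 ≤ t) :
    ‖rsChi (σ + t * I) - (((t / (2 * π)) ^ (1 / 2 - σ) : ℝ) : ℂ) *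
        cexp ((π / 4 + t - t * Real.log (t / (2 * π))) * I)‖ ≤
      38 * (A + 1) ^ 2 / t * (t / (2 * π)) ^ (1 / 2 - σ) := by
  obtain ⟨η, hη, h⟩ := rsChi_stirling_of_abs_le hA hσA ht
  have ht0 : 0 < t := by nlinarith [one_le_pow₀ (n := 2) (show (1 : ℝ) ≤ A + 1 by linarith)]
  have hpos : 0 ≤ (t / (2 * π)) ^ (1 / 2 - σ) := Real.rpow_nonneg (by positivity) _
  have hC : 0 ≤ 38 * (A + 1) ^ 2 / t := by positivity
  have hphase : ‖cexp ((π / 4 + t - t * Real.log (t / (2 * π))) * I)‖ = 1 := by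
    have := Complex.norm_exp_ofReal_mul_I (π / 4 + t - t * Real.log (t / (2 * π)))
    push_cast at this
    exact this
  rw [h, show ∀ M : ℂ, M * (1 + η) - M = M * η from fun M ↦ by ring, norm_mul, norm_mul, hphase,
    mul_one, Complex.norm_real, Real.norm_of_nonneg hpos, mul_comm]
  gcongr

/-- **`|χ(σ+it)| = (t/2π)^{½−σ} (1 + O_A(1/t))`**: for `1 ≤ A`, `|σ| ≤ A`, `t ≥ 38(A+1)²`,
`|‖χ(σ+it)‖ − (t/2π)^{½−σ}| ≤ (38(A+1)²/t) (t/2π)^{½−σ}`. [cite: Titchmarsh1986, §4.12 eq. (4.12.3)] -/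
theorem abs_norm_rsChi_sub_rpow_le {A σ t : ℝ} (hA : 1 ≤ A) (hσA : |σ| ≤ A)
    (ht : 38 * (A + 1) ^ 2 ≤ t) :
    |‖rsChi (σ + t * I)‖ - (t / (2 * π)) ^ (1 / 2 - σ)| ≤
      38 * (A + 1) ^ 2 / t * (t / (2 * π)) ^ (1 / 2 - σ) := by
  have h := norm_rsChi_sub_stirling_le hA hσA ht
  have ht0 : 0 < t := by nlinarith [one_le_pow₀ (n := 2) (show (1 : ℝ) ≤ A + 1 by linarith)]
  have hpos : 0 ≤ (t / (2 * π)) ^ (1 / 2 - σ) := Real.rpow_nonneg (by positivity) _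
  have hM : ‖(((t / (2 * π)) ^ (1 / 2 - σ) : ℝ) : ℂ) *
      cexp ((π / 4 + t - t * Real.log (t / (2 * π))) * I)‖ = (t / (2 * π)) ^ (1 / 2 - σ) := by
    have h1 := Complex.norm_exp_ofReal_mul_I (π / 4 + t - t * Real.log (t / (2 * π)))
    push_cast at h1
    rw [norm_mul, h1, mul_one, Complex.norm_real, Real.norm_of_nonneg hpos]
  calc |‖rsChi (σ + t * I)‖ - (t / (2 * π)) ^ (1 / 2 - σ)|
      = |‖rsChi (σ + t * I)‖ - ‖(((t / (2 * π)) ^ (1 / 2 - σ) : ℝ) : ℂ) *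
          cexp ((π / 4 + t - t * Real.log (t / (2 * π))) * I)‖| := by rw [hM]
    _ ≤ _ := abs_norm_sub_norm_le _ _
    _ ≤ _ := h

/-- The same asymptotic for the tree's `riemannZetaChi` (`= rsChi` off the integers,
`Literature.NumberTheory.LFunctions.SiegelIntegral.rsChi_eq_riemannZetaChi`): for `1 ≤ A`,
`|σ| ≤ A`, `t ≥ 38(A+1)²`, `χ(σ+it) = (t/2π)^{½−σ} e^{i(π/4 + t − t log(t/2π))} (1 + η)`,
`‖η‖ ≤ 38(A+1)²/t`. [cite: Titchmarsh1986, §4.12 eq. (4.12.3)] -/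
theorem riemannZetaChi_stirling_of_abs_le {A σ t : ℝ} (hA : 1 ≤ A) (hσA : |σ| ≤ A)
    (ht : 38 * (A + 1) ^ 2 ≤ t) :
    ∃ η : ℂ, ‖η‖ ≤ 38 * (A + 1) ^ 2 / t ∧
      riemannZetaChi (σ + t * I) = (((t / (2 * π)) ^ (1 / 2 - σ) : ℝ) : ℂ) *
        cexp ((π / 4 + t - t * Real.log (t / (2 * π))) * I) * (1 + η) := by
  have ht0 : 0 < t := by nlinarith [one_le_pow₀ (n := 2) (show (1 : ℝ) ≤ A + 1 by linarith)]
  have htI : ((σ : ℂ) + t * I).im ≠ 0 := by simpa using ht0.ne'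
  rw [← rsChi_eq_riemannZetaChi (sin_pi_mul_ne_zero htI)]
  exact rsChi_stirling_of_abs_le hA hσA ht


end Literature.NumberTheory.LFunctions
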